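import Summits.ValiantsHypothesis.ValiantsHypothesis.Theses.SliceSignRank

/-!
# ValiantsHypothesis / SliceSignRank — items `CruxesToTarget` (stmt-ValiantsHypothesis-15120) and
# `TargetToVH` (stmt-ValiantsHypothesis-15121), closed

* `CruxesToTarget`: `SignRankSuperQP → PositiveSliceNormalForm → PositivePatternHard` — a positive
  slice `VP` family would have quasi-polynomial real sign-representations of `sgn` on `S_n` for all
  `n ≥ 1` (its permutation coefficients are positive reals `r = sgn σ · Σ_t Π_i W_t(σ i, i)`),
  contradicting the sign-rank lower bound at `n = max n₀ 1`.
* `TargetToVH`: `PositivePatternHard → ValiantsHypothesis` — the permanent is a positive slice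
  family (`coeff_perPoly`, `coeff_permMonomial_perPoly`), lies in `VNP` (`perFamily_mem_VNP_holds`)
  and the renaming bridge `mem_VP_ofFintype_iff_holds` turns `VP ℂ = VNP ℂ` into `IsVPFamily per`.
Both are the two halves of the route's deciding theorem `closes`; pure logic over PROVED tree facts.
HONEST FRAMING: bookkeeping; the cruxes are OPEN; nothing here is progress on `VP ≠ VNP`.
-/

-- layout Summits/ValiantsHypothesis/ValiantsHypothesis forces the duplicated namespace component
set_option linter.dupNamespace false

namespace Summit.ValiantsHypothesis.ValiantsHypothesis.Theorems.SliceSignRank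

open Literature.Computability.AlgebraicComplexity

/-- **Item `CruxesToTarget` (stmt-ValiantsHypothesis-15120):**
`SignRankSuperQP → PositiveSliceNormalForm → PositivePatternHard`. [folklore] -/
theorem cruxesToTarget_proof : Theses.SliceSignRank.CruxesToTarget := by
  unfold Theses.SliceSignRank.CruxesToTarget Theses.SliceSignRank.SignRankSuperQP
    Theses.SliceSignRank.PositiveSliceNormalForm Theses.SliceSignRank.PositivePatternHard
  intro hS hF f h0 h1 hVP
  obtain ⟨c, hc⟩ := hF f h0 h1 hVP
  obtain ⟨n₀, hn₀⟩ := hS c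
  obtain ⟨k, hk, W, hW⟩ := hc (max n₀ 1) (le_max_right _ _)
  refine hn₀ (max n₀ 1) (le_max_left _ _) k hk ⟨W, fun σ => ?_⟩
  obtain ⟨r, hr, hrσ⟩ := h1 (max n₀ 1) σ
  have h := hW σ
  rw [hrσ] at h
  have h' : (((Equiv.Perm.sign σ : ℤ) : ℝ) * ∑ t, ∏ i, W t (σ i) i : ℝ) = r := by
    apply Complex.ofReal_injective
    push_cast
    exact h.symm
  rw [h']
  exact hr

/-- **Item `TargetToVH` (stmt-ValiantsHypothesis-15121):** `PositivePatternHard → ValiantsHypothesis`.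
[folklore] -/
theorem targetToVH_proof : Theses.SliceSignRank.TargetToVH := by
  unfold Theses.SliceSignRank.TargetToVH Theses.SliceSignRank.PositivePatternHard
  intro hP
  show VP ℂ ≠ VNP ℂ
  intro hEq
  have hVP : IsVPFamily (fun n => perPoly (Fin n) ℂ) := by
    refine (mem_VP_ofFintype_iff_holds _).1 ?_
    rw [hEq]
    exact perFamily_mem_VNP_holds ℂ
  refine hP (fun n => perPoly (Fin n) ℂ) ?_ ?_ hVP
  · intro n d hd
    rw [coeff_perPoly]
    exact Finset.sum_eq_zero fun ρ _ => if_neg (hd ρ)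
  · intro n ρ
    refine ⟨1, one_pos, ?_⟩
    rw [coeff_permMonomial_perPoly]
    simp

end Summit.ValiantsHypothesis.ValiantsHypothesis.Theorems.SliceSignRank
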